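import Mathlib
import Summits.RiemannHypothesis.RiemannHypothesis.Theorems.SoloBlindDeepPair

/-!
# One deep pair in the critical lattice is INVISIBLE down to `4a·sinh²(δa) ≤ T′` — the parity split

Soloist `solo-RiemannHypothesis-blind`, kernel artefact 13 (report `paper/window-height.md` §11.1,
claim C50). Setting of artefact 12 (`SoloBlindDeepPair`): the on-line lattice `sℤ`, `T′ = 2π/s`,
with the site `0` replaced by the conjugate pair `∓iδ`; for a test function `g ∈ L²` supported in
`(-a, a]` with `2a ≤ T′` the zero-side functional is (`soloBlind_deepPair_hasSum` at `u₀ = 0`)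
`Q = T′‖g‖² − |H(0)|² + 2 Re[H(−iδ)·conj H(iδ)]`, `H(z) = ∫ g(x) e^{izx} dx`.

Artefact 12 proved the VISIBILITY half (two-bump functions give `Q < 0` once
`4w·sinh²(δ(a − w/2)) > T′`). This file proves the INVISIBILITY half with the report's constant:
if `2a ≤ T′` and `4a·sinh²(δa) ≤ T′` then `Q ≥ 0` for EVERY `g ∈ L²` supported in `(-a, a]`
(`soloBlind_deepPair_invisible`, `soloBlind_deepPair_tsum_nonneg`). With the certificate of the
report (§10.5) the critical depth of one pair in the lattice is thus pinned on both sides.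

Proof = the parity split of §11.1. With `C = ∫ g·cosh(δx)`, `S = ∫ g·sinh(δx)`:
`H(−iδ) = C + S`, `H(iδ) = C − S`, so the pair term equals `2|C|² − 2|S|²` (pure algebra,
`soloBlind_pairTerm_re`). With `E(x) = g(x) + g(−x)`, `O(x) = g(x) − g(−x)`:
`∫ E = 2∫ g`, `∫ O·sinh(δ·) = 2S`, `‖E‖² + ‖O‖² = 4‖g‖²` (parallelogram law + reflection invariance of
Lebesgue measure), and Cauchy–Schwarz on `[−a, a]` in variance form (`soloBlind_sq_setIntegral_le`)
gives `|∫E|² ≤ 2a‖E‖²`, `|∫ O sinh|² ≤ sinh²(δa)·2a‖O‖²`; hence `|H(0)|² + 2|S|² ≤ T′‖g‖²`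
(`soloBlind_parity_core`) and `Q ≥ 2|C|² ≥ 0`. Mathlib only (+ artefact 12 for the closed form);
no new definitions.
-/

open MeasureTheory Complex Set
open scoped Real ComplexConjugate

namespace Summit.RiemannHypothesis.RiemannHypothesis.Theorems

/-- Pure algebra of the pair term after the cosh/sinh split:
`2 Re[(C+S)·conj(C−S)] = 2|C|² − 2|S|²`. -/
theorem soloBlind_pairTerm_re (C S : ℂ) :
    2 * ((C + S) * conj (C - S)).re = 2 * ‖C‖ ^ 2 - 2 * ‖S‖ ^ 2 := by
  simp only [Complex.mul_re, Complex.add_re, Complex.add_im, map_sub, Complex.sub_re,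
    Complex.sub_im, Complex.conj_re, Complex.conj_im, Complex.sq_norm, Complex.normSq_apply]
  ring

/-- Cauchy–Schwarz on `[-a, a]` in variance form: `(∫ f)² ≤ 2a · ∫ f²`. -/
theorem soloBlind_sq_setIntegral_le (a : ℝ) (ha : 0 < a) {f : ℝ → ℝ}
    (hfi : Integrable f (volume.restrict (Icc (-a) a)))
    (hf2 : Integrable (fun x => f x ^ 2) (volume.restrict (Icc (-a) a))) :
    (∫ x in Icc (-a) a, f x) ^ 2 ≤ (2 * a) * ∫ x in Icc (-a) a, f x ^ 2 := by
  set μ : Measure ℝ := volume.restrict (Icc (-a) a) with hμ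
  haveI : IsFiniteMeasure μ := isFiniteMeasure_restrict.mpr (by simp [Real.volume_Icc])
  have hμu : μ.real univ = 2 * a := by
    rw [hμ, measureReal_restrict_apply_univ, Real.volume_real_Icc, max_eq_left (by linarith)]
    ring
  have h2a : 0 < 2 * a := by linarith
  have h2a' : (2 * a) ≠ 0 := h2a.ne'
  set m : ℝ := (∫ x, f x ∂μ) / (2 * a) with hm
  have hlin : Integrable (fun x => 2 * m * f x) μ := hfi.const_mul (2 * m)
  have hexp : ∫ x, (f x - m) ^ 2 ∂μ
      = (∫ x, f x ^ 2 ∂μ) - 2 * m * (∫ x, f x ∂μ) + m ^ 2 * (2 * a) := by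
    have hpt : (fun x => (f x - m) ^ 2) = fun x => (f x ^ 2 - 2 * m * f x) + m ^ 2 := by
      funext x; ring
    rw [hpt, integral_add (hf2.sub' hlin) (integrable_const _), integral_sub hf2 hlin,
      integral_const_mul, integral_const, hμu, smul_eq_mul]
    ring
  have hnn : 0 ≤ ∫ x, (f x - m) ^ 2 ∂μ := integral_nonneg fun x => sq_nonneg _
  have key : (∫ x, f x ∂μ) ^ 2 / (2 * a) ≤ ∫ x, f x ^ 2 ∂μ := by
    have e : (∫ x, f x ^ 2 ∂μ) - 2 * m * (∫ x, f x ∂μ) + m ^ 2 * (2 * a)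
        = (∫ x, f x ^ 2 ∂μ) - (∫ x, f x ∂μ) ^ 2 / (2 * a) := by
      rw [hm]; field_simp; ring
    rw [hexp, e] at hnn
    linarith
  calc (∫ x, f x ∂μ) ^ 2 = ((∫ x, f x ∂μ) ^ 2 / (2 * a)) * (2 * a) := by
        rw [div_mul_cancel₀ _ h2a']
    _ ≤ (∫ x, f x ^ 2 ∂μ) * (2 * a) := mul_le_mul_of_nonneg_right key h2a.le
    _ = (2 * a) * ∫ x, f x ^ 2 ∂μ := by ring

/-- Integrability of `g · w` for an integrable `g` supported in `(-a, a]` and a continuous real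
weight `w` bounded on `[-a, a]`. -/
theorem soloBlind_integrable_mul_weight {g : ℝ → ℂ} {a : ℝ} (hgi : Integrable g)
    (hsupp : Function.support g ⊆ Ioc (-a) a) {w : ℝ → ℝ} (hw : Continuous w) (W : ℝ)
    (hW : ∀ x ∈ Icc (-a) a, |w x| ≤ W) :
    Integrable (fun x => g x * ((w x : ℝ) : ℂ)) := by
  have hbound : ∀ x, ‖g x * ((w x : ℝ) : ℂ)‖ ≤ W * ‖g x‖ := by
    intro x
    by_cases hx : g x = 0
    · simp [hx]
    · have hxI : x ∈ Icc (-a) a := Ioc_subset_Icc_self (hsupp hx)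
      rw [norm_mul, Complex.norm_real, Real.norm_eq_abs, mul_comm (‖g x‖) (|w x|)]
      exact mul_le_mul_of_nonneg_right (hW x hxI) (norm_nonneg _)
  have hmeas : AEStronglyMeasurable (fun x => g x * ((w x : ℝ) : ℂ)) volume :=
    hgi.aestronglyMeasurable.mul (Complex.continuous_ofReal.comp hw).aestronglyMeasurable
  exact (hgi.norm.const_mul W).mono' hmeas (Filter.Eventually.of_forall hbound)

/-- **The parity-split inequality.** For `g` integrable with `‖g‖²` integrable, supported in
`(-a, a]`, `0 ≤ δ`, `2a ≤ T`, `4a·sinh²(δa) ≤ T`: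
`|∫ g|² + 2|∫ g·sinh(δx)|² ≤ T·∫‖g‖²`. -/
theorem soloBlind_parity_core (a δ T : ℝ) (ha : 0 < a) (hδ : 0 ≤ δ) (haT : 2 * a ≤ T)
    (hδT : 4 * a * Real.sinh (δ * a) ^ 2 ≤ T) {g : ℝ → ℂ} (hgi : Integrable g)
    (hg2 : Integrable (fun x => ‖g x‖ ^ 2)) (hsupp : Function.support g ⊆ Ioc (-a) a) :
    ‖∫ x, g x‖ ^ 2 + 2 * ‖∫ x, g x * ((Real.sinh (δ * x) : ℝ) : ℂ)‖ ^ 2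
      ≤ T * ∫ x, ‖g x‖ ^ 2 := by
  -- `g` and its reflection vanish off the closed window
  have hg0 : ∀ x, x ∉ Icc (-a) a → g x = 0 := by
    intro x hx
    by_contra h
    exact hx (Ioc_subset_Icc_self (hsupp h))
  have hg0' : ∀ x, x ∉ Icc (-a) a → g (-x) = 0 := by
    intro x hx
    apply hg0
    intro h
    exact hx ⟨by linarith [h.2], by linarith [h.1]⟩
  -- the weight `w = sinh(δ·)` and its bound on the window
  set w : ℝ → ℂ := fun x => ((Real.sinh (δ * x) : ℝ) : ℂ) with hw
  show ‖∫ x, g x‖ ^ 2 + 2 * ‖∫ x, g x * w x‖ ^ 2 ≤ T * ∫ x, ‖g x‖ ^ 2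
  have hw_neg : ∀ x, w (-x) = -w x := by
    intro x
    simp only [hw]
    rw [mul_neg, Real.sinh_neg, Complex.ofReal_neg]
  have hw_norm : ∀ x, ‖w x‖ = |Real.sinh (δ * x)| := by
    intro x
    simp only [hw]
    rw [Complex.norm_real, Real.norm_eq_abs]
  have hWs : ∀ x ∈ Icc (-a) a, |Real.sinh (δ * x)| ≤ Real.sinh (δ * a) := by
    intro x hx
    rw [abs_le]
    constructor
    · rw [← Real.sinh_neg, Real.sinh_le_sinh]
      nlinarith [mul_nonneg hδ (show 0 ≤ x + a by linarith [hx.1])]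
    · rw [Real.sinh_le_sinh]
      nlinarith [mul_nonneg hδ (show 0 ≤ a - x by linarith [hx.2])]
  -- even / odd doubles
  set E : ℝ → ℂ := fun x => g x + g (-x) with hE
  set O : ℝ → ℂ := fun x => g x - g (-x) with hO
  have hgn : Integrable (fun x => g (-x)) := hgi.comp_neg
  have hE_i : Integrable E := hgi.add hgn
  have hO_i : Integrable O := hgi.sub hgn
  have hE0 : ∀ x, x ∉ Icc (-a) a → E x = 0 := fun x hx => by
    simp only [hE, hg0 x hx, hg0' x hx, add_zero]
  have hO0 : ∀ x, x ∉ Icc (-a) a → O x = 0 := fun x hx => by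
    simp only [hO, hg0 x hx, hg0' x hx, sub_zero]
  -- (1) ∫ E = 2 ∫ g
  have hE_int : ∫ x, E x = 2 * ∫ x, g x := by
    simp only [hE]
    rw [integral_add hgi hgn, integral_neg_eq_self g volume]
    ring
  -- (2) ∫ O·w = 2 ∫ g·w
  have hgw_i : Integrable (fun x => g x * w x) :=
    soloBlind_integrable_mul_weight (w := fun x => Real.sinh (δ * x)) hgi hsupp
      (Real.continuous_sinh.comp (continuous_const.mul continuous_id)) (Real.sinh (δ * a)) hWs
  have hgnw_i : Integrable (fun x => g (-x) * w x) := by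
    have h1 : Integrable (fun x => -(g (-x) * w (-x))) := (hgw_i.comp_neg).neg
    refine h1.congr (Filter.Eventually.of_forall fun x => ?_)
    show -(g (-x) * w (-x)) = g (-x) * w x
    rw [hw_neg]; ring
  have hgnw_int : ∫ x, g (-x) * w x = -∫ x, g x * w x := by
    have h : ∫ x, g (-x) * w (-x) = ∫ x, g x * w x :=
      integral_neg_eq_self (fun x => g x * w x) volume
    calc ∫ x, g (-x) * w x = ∫ x, -(g (-x) * w (-x)) := by
          congr 1; funext x; rw [hw_neg]; ring
      _ = -∫ x, g (-x) * w (-x) := integral_neg _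
      _ = -∫ x, g x * w x := by rw [h]
  have hO_int : ∫ x, O x * w x = 2 * ∫ x, g x * w x := by
    have hpt : (fun x => O x * w x) = fun x => g x * w x - g (-x) * w x := by
      funext x; simp only [hO]; ring
    rw [hpt, integral_sub hgw_i hgnw_i, hgnw_int]
    ring
  -- (3) ∫‖E‖² + ∫‖O‖² = 4 ∫‖g‖²
  have hg2n : Integrable (fun x => ‖g (-x)‖ ^ 2) := hg2.comp_neg
  have hpar : ∀ x, ‖E x‖ ^ 2 + ‖O x‖ ^ 2 = 2 * (‖g x‖ ^ 2 + ‖g (-x)‖ ^ 2) := by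
    intro x
    simp only [hE, hO]
    exact parallelogram_law_with_norm ℂ (g x) (g (-x))
  have hdom : Integrable (fun x => 2 * (‖g x‖ ^ 2 + ‖g (-x)‖ ^ 2)) := (hg2.add hg2n).const_mul 2
  have hE2 : Integrable (fun x => ‖E x‖ ^ 2) := by
    refine hdom.mono' ((continuous_pow 2).comp_aestronglyMeasurable hE_i.aestronglyMeasurable.norm)
      (Filter.Eventually.of_forall fun x => ?_)
    rw [Real.norm_eq_abs, abs_of_nonneg (sq_nonneg _)]
    nlinarith [hpar x, sq_nonneg ‖O x‖]
  have hO2 : Integrable (fun x => ‖O x‖ ^ 2) := by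
    refine hdom.mono' ((continuous_pow 2).comp_aestronglyMeasurable hO_i.aestronglyMeasurable.norm)
      (Filter.Eventually.of_forall fun x => ?_)
    rw [Real.norm_eq_abs, abs_of_nonneg (sq_nonneg _)]
    nlinarith [hpar x, sq_nonneg ‖E x‖]
  have hrefl : ∫ x, ‖g (-x)‖ ^ 2 = ∫ x, ‖g x‖ ^ 2 :=
    integral_neg_eq_self (fun x => ‖g x‖ ^ 2) volume
  have hsplit : (∫ x, ‖E x‖ ^ 2) + ∫ x, ‖O x‖ ^ 2 = 4 * ∫ x, ‖g x‖ ^ 2 := by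
    calc (∫ x, ‖E x‖ ^ 2) + ∫ x, ‖O x‖ ^ 2 = ∫ x, (‖E x‖ ^ 2 + ‖O x‖ ^ 2) :=
          (integral_add hE2 hO2).symm
      _ = ∫ x, 2 * (‖g x‖ ^ 2 + ‖g (-x)‖ ^ 2) := by
          congr 1; funext x; exact hpar x
      _ = 2 * ((∫ x, ‖g x‖ ^ 2) + ∫ x, ‖g (-x)‖ ^ 2) := by
          rw [integral_const_mul, integral_add hg2 hg2n]
      _ = 4 * ∫ x, ‖g x‖ ^ 2 := by rw [hrefl]; ring
  -- (4) Cauchy–Schwarz for E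
  have hXE : 0 ≤ ∫ x, ‖E x‖ ^ 2 := integral_nonneg fun x => sq_nonneg _
  have hXO : 0 ≤ ∫ x, ‖O x‖ ^ 2 := integral_nonneg fun x => sq_nonneg _
  have hJE : ∫ x in Icc (-a) a, ‖E x‖ = ∫ x, ‖E x‖ :=
    setIntegral_eq_integral_of_forall_compl_eq_zero fun x hx => by rw [hE0 x hx]; simp
  have hKE : ∫ x in Icc (-a) a, ‖E x‖ ^ 2 = ∫ x, ‖E x‖ ^ 2 :=
    setIntegral_eq_integral_of_forall_compl_eq_zero fun x hx => by rw [hE0 x hx]; simp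
  have hJO : ∫ x in Icc (-a) a, ‖O x‖ = ∫ x, ‖O x‖ :=
    setIntegral_eq_integral_of_forall_compl_eq_zero fun x hx => by rw [hO0 x hx]; simp
  have hKO : ∫ x in Icc (-a) a, ‖O x‖ ^ 2 = ∫ x, ‖O x‖ ^ 2 :=
    setIntegral_eq_integral_of_forall_compl_eq_zero fun x hx => by rw [hO0 x hx]; simp
  have hcsE : (∫ x in Icc (-a) a, ‖E x‖) ^ 2 ≤ (2 * a) * ∫ x in Icc (-a) a, ‖E x‖ ^ 2 :=
    soloBlind_sq_setIntegral_le a ha (f := fun x => ‖E x‖) hE_i.norm.integrableOn hE2.integrableOn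
  have hcsO : (∫ x in Icc (-a) a, ‖O x‖) ^ 2 ≤ (2 * a) * ∫ x in Icc (-a) a, ‖O x‖ ^ 2 :=
    soloBlind_sq_setIntegral_le a ha (f := fun x => ‖O x‖) hO_i.norm.integrableOn hO2.integrableOn
  rw [hJE, hKE] at hcsE
  rw [hJO, hKO] at hcsO
  have hCS_E : ‖∫ x, E x‖ ^ 2 ≤ (2 * a) * ∫ x, ‖E x‖ ^ 2 :=
    calc ‖∫ x, E x‖ ^ 2 ≤ (∫ x, ‖E x‖) ^ 2 :=
          pow_le_pow_left₀ (norm_nonneg _) (norm_integral_le_integral_norm _) 2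
      _ ≤ (2 * a) * ∫ x, ‖E x‖ ^ 2 := hcsE
  -- (5) Cauchy–Schwarz for O with the sinh weight
  have hOw_i : Integrable (fun x => O x * w x) := by
    have hpt : (fun x => O x * w x) = fun x => g x * w x - g (-x) * w x := by
      funext x; simp only [hO]; ring
    rw [hpt]; exact hgw_i.sub hgnw_i
  have hpt_bound : ∀ x, ‖O x * w x‖ ≤ Real.sinh (δ * a) * ‖O x‖ := by
    intro x
    by_cases hx : O x = 0
    · simp [hx]
    · have hxI : x ∈ Icc (-a) a := by
        by_contra h'
        exact hx (hO0 x h')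
      rw [norm_mul, hw_norm x, mul_comm (‖O x‖) (|Real.sinh (δ * x)|)]
      exact mul_le_mul_of_nonneg_right (hWs x hxI) (norm_nonneg _)
  have hOw_norm : ‖∫ x, O x * w x‖ ≤ Real.sinh (δ * a) * ∫ x, ‖O x‖ :=
    calc ‖∫ x, O x * w x‖ ≤ ∫ x, ‖O x * w x‖ := norm_integral_le_integral_norm _
      _ ≤ ∫ x, Real.sinh (δ * a) * ‖O x‖ :=
          integral_mono hOw_i.norm (hO_i.norm.const_mul _) fun x => hpt_bound x
      _ = Real.sinh (δ * a) * ∫ x, ‖O x‖ := integral_const_mul _ _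
  have hCS_O : ‖∫ x, O x * w x‖ ^ 2 ≤ Real.sinh (δ * a) ^ 2 * ((2 * a) * ∫ x, ‖O x‖ ^ 2) :=
    calc ‖∫ x, O x * w x‖ ^ 2 ≤ (Real.sinh (δ * a) * ∫ x, ‖O x‖) ^ 2 :=
          pow_le_pow_left₀ (norm_nonneg _) hOw_norm 2
      _ = Real.sinh (δ * a) ^ 2 * (∫ x, ‖O x‖) ^ 2 := by ring
      _ ≤ Real.sinh (δ * a) ^ 2 * ((2 * a) * ∫ x, ‖O x‖ ^ 2) :=
          mul_le_mul_of_nonneg_left hcsO (sq_nonneg _)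
  -- (6) assembly
  have hI1 : ‖∫ x, g x‖ ^ 2 = (1 / 4) * ‖∫ x, E x‖ ^ 2 := by
    rw [hE_int, norm_mul, Complex.norm_ofNat]; ring
  have hI2 : ‖∫ x, g x * w x‖ ^ 2 = (1 / 4) * ‖∫ x, O x * w x‖ ^ 2 := by
    rw [hO_int, norm_mul, Complex.norm_ofNat]; ring
  have p1 : (a / 2) * (∫ x, ‖E x‖ ^ 2) ≤ (T / 4) * ∫ x, ‖E x‖ ^ 2 :=
    mul_le_mul_of_nonneg_right (by linarith) hXE
  have p2 : (a * Real.sinh (δ * a) ^ 2) * (∫ x, ‖O x‖ ^ 2) ≤ (T / 4) * ∫ x, ‖O x‖ ^ 2 :=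
    mul_le_mul_of_nonneg_right (by linarith) hXO
  have hsplitT : (T / 4) * (∫ x, ‖E x‖ ^ 2) + (T / 4) * (∫ x, ‖O x‖ ^ 2)
      = T * ∫ x, ‖g x‖ ^ 2 := by
    rw [← mul_add, hsplit]; ring
  rw [hI1, hI2]
  linarith [hCS_E, hCS_O, p1, p2, hsplitT]

/-- **One deep pair in the critical lattice is invisible down to `4a·sinh²(δa) ≤ T′`.**
For `g ∈ L²` supported in `(-a, a]`, `T′ = 2π/s ≥ 2a`, `0 ≤ δ` with `4a·sinh²(δa) ≤ T′`, the value
of the zero-side functional of `Z₁(δ)` (artefact 12, `u₀ = 0`) is `≥ 0`. -/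
theorem soloBlind_deepPair_invisible (s δ a : ℝ) (ha : 0 < a) (hδ : 0 ≤ δ)
    (haT : 2 * a ≤ 2 * π / s) (hδT : 4 * a * Real.sinh (δ * a) ^ 2 ≤ 2 * π / s)
    {g : ℝ → ℂ} (hg : MemLp g 2 volume) (hsupp : Function.support g ⊆ Ioc (-a) a) :
    0 ≤ (2 * π / s) * (∫ x : ℝ, ‖g x‖ ^ 2)
        - ‖(∫ x : ℝ, g x * cexp (I * (((0 : ℝ) : ℂ)) * (x : ℂ)))‖ ^ 2
        + 2 * ((∫ x : ℝ, g x * cexp (I * (((0 : ℝ) : ℂ) - I * δ) * (x : ℂ))) *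
            conj ((∫ x : ℝ, g x * cexp (I * (((0 : ℝ) : ℂ) + I * δ) * (x : ℂ))))).re := by
  -- integrability from `L²` and bounded support
  have hgi : Integrable g := by
    have hm : MemLp g 2 (volume.restrict (Ioc (-a) a)) := hg.restrict _
    haveI : IsFiniteMeasure (volume.restrict (Ioc (-a) a)) :=
      isFiniteMeasure_restrict.mpr (by simp [Real.volume_Ioc])
    have h1 : IntegrableOn g (Ioc (-a) a) := hm.integrable one_le_two
    exact (integrableOn_iff_integrable_of_support_subset hsupp).mp h1
  have hg2 : Integrable (fun x => ‖g x‖ ^ 2) := (memLp_two_iff_integrable_sq_norm hg.1).mp hg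
  -- the weights cosh, sinh on the window
  have hWs : ∀ x ∈ Icc (-a) a, |Real.sinh (δ * x)| ≤ Real.sinh (δ * a) := by
    intro x hx
    rw [abs_le]
    constructor
    · rw [← Real.sinh_neg, Real.sinh_le_sinh]
      nlinarith [mul_nonneg hδ (show 0 ≤ x + a by linarith [hx.1])]
    · rw [Real.sinh_le_sinh]
      nlinarith [mul_nonneg hδ (show 0 ≤ a - x by linarith [hx.2])]
  have hWc : ∀ x ∈ Icc (-a) a, |Real.cosh (δ * x)| ≤ Real.cosh (δ * a) := by
    intro x hx
    rw [abs_of_pos (Real.cosh_pos _), Real.cosh_le_cosh, abs_mul, abs_mul, abs_of_nonneg hδ,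
      abs_of_pos ha]
    exact mul_le_mul_of_nonneg_left (abs_le.mpr ⟨by linarith [hx.1], hx.2⟩) hδ
  have hsinh_i : Integrable (fun x => g x * ((Real.sinh (δ * x) : ℝ) : ℂ)) :=
    soloBlind_integrable_mul_weight (w := fun x => Real.sinh (δ * x)) hgi hsupp
      (Real.continuous_sinh.comp (continuous_const.mul continuous_id)) (Real.sinh (δ * a)) hWs
  have hcosh_i : Integrable (fun x => g x * ((Real.cosh (δ * x) : ℝ) : ℂ)) :=
    soloBlind_integrable_mul_weight (w := fun x => Real.cosh (δ * x)) hgi hsupp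
      (Real.continuous_cosh.comp (continuous_const.mul continuous_id)) (Real.cosh (δ * a)) hWc
  -- the three transforms in terms of `∫ g`, `C = ∫ g cosh`, `S = ∫ g sinh`
  have h0 : (∫ x : ℝ, g x * cexp (I * (((0 : ℝ) : ℂ)) * (x : ℂ))) = ∫ x, g x := by
    congr 1; funext x; simp
  have hp : (∫ x : ℝ, g x * cexp (I * (((0 : ℝ) : ℂ) - I * δ) * (x : ℂ)))
      = (∫ x, g x * ((Real.cosh (δ * x) : ℝ) : ℂ)) + ∫ x, g x * ((Real.sinh (δ * x) : ℝ) : ℂ) := by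
    rw [← integral_add hcosh_i hsinh_i]
    congr 1; funext x
    rw [show I * (((0 : ℝ) : ℂ) - I * δ) * (x : ℂ) = ((δ * x : ℝ) : ℂ) by
      push_cast; ring_nf; rw [I_sq]; ring]
    rw [← Complex.ofReal_exp, ← Real.cosh_add_sinh]
    push_cast
    ring
  have hm : (∫ x : ℝ, g x * cexp (I * (((0 : ℝ) : ℂ) + I * δ) * (x : ℂ)))
      = (∫ x, g x * ((Real.cosh (δ * x) : ℝ) : ℂ)) - ∫ x, g x * ((Real.sinh (δ * x) : ℝ) : ℂ) := by
    rw [← integral_sub hcosh_i hsinh_i]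
    congr 1; funext x
    rw [show I * (((0 : ℝ) : ℂ) + I * δ) * (x : ℂ) = ((-(δ * x) : ℝ) : ℂ) by
      push_cast; ring_nf; rw [I_sq]; ring]
    rw [← Complex.ofReal_exp, ← Real.cosh_sub_sinh]
    push_cast
    ring
  rw [h0, hp, hm, soloBlind_pairTerm_re]
  have core := soloBlind_parity_core a δ (2 * π / s) ha hδ haT hδT hgi hg2 hsupp
  linarith [core, sq_nonneg ‖∫ x, g x * ((Real.cosh (δ * x) : ℝ) : ℂ)‖]

/-- **The zero-side functional of `Z₁(δ)` is nonnegative on the whole window** (invisibility for all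
test functions): the sum over the configuration — the pair term at `j = 0`, `|H(js)|²` at the other
sites — converges (artefact 12) and its value is `≥ 0` under `2a ≤ T′`, `4a·sinh²(δa) ≤ T′`. -/
theorem soloBlind_deepPair_tsum_nonneg (s δ a : ℝ) (hs : 0 < s) (ha : 0 < a) (hδ : 0 ≤ δ)
    (haT : 2 * a ≤ 2 * π / s) (hδT : 4 * a * Real.sinh (δ * a) ^ 2 ≤ 2 * π / s)
    {g : ℝ → ℂ} (hg : MemLp g 2 volume) (hsupp : Function.support g ⊆ Ioc (-a) a) :
    0 ≤ ∑' j : ℤ, (if j = 0 then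
        2 * ((∫ x : ℝ, g x * cexp (I * (((0 : ℝ) : ℂ) - I * δ) * (x : ℂ))) *
            conj ((∫ x : ℝ, g x * cexp (I * (((0 : ℝ) : ℂ) + I * δ) * (x : ℂ))))).re
      else ‖(∫ x : ℝ, g x * cexp (I * ((((0 : ℝ) + j * s : ℝ) : ℂ)) * (x : ℂ)))‖ ^ 2) := by
  have hsupp' : Function.support g ⊆ Ioc (-a) (-a + 2 * π / s) :=
    hsupp.trans (Ioc_subset_Ioc_right (by linarith))
  have h := soloBlind_deepPair_hasSum (-a) s 0 δ hs hg hsupp'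
  exact (soloBlind_deepPair_invisible s δ a ha hδ haT hδT hg hsupp).trans_eq h.tsum_eq.symm

end Summit.RiemannHypothesis.RiemannHypothesis.Theorems
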